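import Literature.IUT.HodgeArakelov.MonoThetaCyclotomes
import Literature.IUT.HodgeArakelov.MonoThetaFromGroups

/-!
# [IUTchII] §1, Remark 1.4.1 – Remark 1.6.1: pointed inversions, projective systems, cores

Mochizuki, *Inter-universal Teichmüller theory II*, §1, kurims manuscript (Dec. 2020) pp. 27–32:
Remark 1.4.1 (i), (ii); Proposition 1.5 (i)–(iv); Remarks 1.5.1, 1.5.2; Proposition 1.6 (i), (ii);
Remark 1.6.1 [claim: Mochizuki2012, status: disputed] (IUTchII §1 pp.27-32). Record-only typing under the
claim key `Mochizuki2012` (D-0012, disputed): definitions and `Prop`-valued statements only.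

* `IUTchII:Rmk1.4.1(i)`/`(ii)` — the zero cusp, the 2-torsion point `μ_-`, the inversion automorphisms
  `ι_X̲̲`, `ι_Ÿ` and the decomposition group `D_{μ_-}` ("pointed inversion automorphism"), typed
  group-theoretically over `Π ≅ Π^tp_{X̲̲_k}` as `PointedInversion`; the recalled characterisation "an étale
  theta function of standard type is defined precisely by the condition that its restriction to `D_{μ_-}`
  be a `2l`-th root of unity" is the field `standard`.
* `IUTchII:Prop1.5(i)`–`(iv)` — projective systems `M^Θ_* = {… → M^Θ_{M'} → M^Θ_M → …}` indexed
  multiplicatively by `M ∈ ℕ_{≥1}`: `ModelFamily` (the mod-`M` models for all `M`, INTERFACE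
  TODO-merge:abc-iut-L2-t2), `MonoThetaProjSystem`; (ii) transition maps on `Π_X` are isomorphisms and lift;
  (iii) the projective-limit exterior cyclotome `Π_μ(M^Θ_*)` (DEFINED as compatible families), the limit
  cyclotomic rigidity isomorphism and `θ_env(M^Θ_*)`, `∞θ_env(M^Θ_*)` (DEFINED by transport / by the
  printed divisibility condition); (iv) compatibility with the Kummer-theoretic construction (named fact
  over the Frobenioid interface); (i) uniqueness up to isomorphism (named fact).
* `IUTchII:Rmk1.5.1` — expository (discrete rigidity ⇒ compatibility with the monoid `ℕ` of tempered
  Frobenioids); Deliberately NOT typed beyond a docstring: no separately checkable claim.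
* `IUTchII:Rmk1.5.2` — the `Π_X`-equivariant injection `Π_μ(M^Θ_*) ⊗ ℚ/ℤ ↪ lim_J H¹(Π_Ÿ(M^Θ_*)|_J, Π_μ(M^Θ_*))`
  with image the torsion subgroup (named fact over the cohomology interface).
* `IUTchII:Prop1.6(i)`/`(ii)` — cores `Π ⊆ Π_C(Π) ↠ Π/Δ` and elliptic cuspidalisations `Π_{U_N}(Π) ↠ Π`
  ([AbsTopII] Cor. 3.3): OUTPUT structures (existence = owners' construction); `IUTchII:Rmk1.6.1` expository (centralisers /
  chains of elementary operations; Belyi cuspidalisations) — noted in prose only.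

Conventions as in `MonoThetaCyclotomes` (bundled `TopGroup`, OUTPUT-structure encoding of "functorial
algorithm", underline caveat: `X̲` single / `X̲̲` double underline restored from [EtTh] Rmk. 2.3.1, 2.6.1).
-/

namespace Literature.IUT.HodgeArakelov

universe u

variable {S : ThetaSetting.{u}}

/-! ## Remark 1.4.1: pointed inversion automorphisms -/

/-- **IUTchII:Rmk1.4.1(i)** and **IUTchII:Rmk1.4.1(ii)** (kurims pp. 27–29), typed group-theoretically
over `Π ≅ Π^tp_{X̲̲_k}` with its Prop. 1.2 (i) / Prop. 1.4 outputs `E`, `D`. (i): "Write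
`X̲̲_k → X̲_k → C̲_k` for the hyperbolic orbicurves of type `(1,l-tors)`, `(1,l-tors)_±` determined by
`X̲̲_k` [cf. [EtTh], Proposition 2.4]. Thus, `X̲_k` has a unique zero cusp … Write `μ_- ∈ X̲_k(k)` for the
unique torsion point of order `2` whose closure in any stable model … intersects the same irreducible
component of the special fiber … as the zero cusp." (ii): "The unique order two automorphism `ι_X̲̲` of
`X̲̲_k` over `k` [cf. [EtTh], Remark 2.6.1] lies over an order two automorphism `ι_X̲` … and corresponds
at the level of tempered fundamental groups [cf., e.g., [SemiAnbd], Theorem 6.4] to the unique order two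
`Δ^tp_{X̲̲_k}`-outer automorphism of `Π^tp_{X̲̲_k}` over `G_k` … there exists an order two automorphism
`ι_Ÿ` of `Ÿ̲_k` lifting `ι_X̲̲` which is uniquely determined up to `l·ℤ`-conjugacy and composition with
an element `∈ Gal(Ÿ̲_k/Y̲_k)` by the condition that it fix the `Gal(Ÿ̲_k/Y̲_k)`-orbit of some element
… of the `Gal(Ÿ̲_k/X̲̲_k)`-orbit of `(μ_-)_Ÿ` … Write `D_{μ_-} ⊆ Π_{Ÿ̲_k}` for the decomposition group of
`(μ_-)_Ÿ` [which is well-defined up to `Δ^tp_{Ÿ̲_k}`-conjugacy] — so `D_{μ_-}` is determined by `ι_Ÿ` up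
to `Δ^tp_{Y̲_k}`-conjugacy … We shall refer to either of the pairs `(ι_Ÿ, (μ_-)_Ÿ)`,
`(ι_Ÿ ∈ Aut(Π^tp_{Ÿ̲_k})/Inn(Δ^tp_{Ÿ̲_k}), D_{μ_-})` as a pointed inversion automorphism. … an étale
theta function of standard type is defined precisely by the condition that its restriction to `D_{μ_-}`
be a `2l`-th root of unity." The geometric objects enter only through these group-theoretic shadows
(decomposition groups, outer automorphisms). [claim: Mochizuki2012, status: disputed] (IUTchII §1 Rmk 1.4.1, kurims pp.27-29) -/
structure PointedInversion {P : TopGroup.{u}} (E : EnvOfGroup S P) (D : EtaleThetaData S P) :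
    Type (u + 1) where
  /-- a representative of `ι_X̲̲`, the order-two `Δ`-outer automorphism of `Π` over `G_k` -/
  iota : P ≃ₜ* P
  /-- "over `G_k`": compatible with the quotient `Π ≅ Π_X(M^Θ(Π)) ↠ G` -/
  iota_over_G : ∀ x : P, E.recon.projG (E.isoX (iota x)) = E.recon.projG (E.isoX x)
  /-- order two as an outer automorphism: `ι²` is inner by an element of `Δ = Ker(Π ↠ G)` -/
  iota_sq_inner : ∃ δ : P, E.recon.projG (E.isoX δ) = 1 ∧ ∀ x : P, iota (iota x) = δ * x * δ⁻¹
  /-- `ι` itself is not `Δ`-inner -/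
  iota_not_inner : ¬ ∃ δ : P, E.recon.projG (E.isoX δ) = 1 ∧ ∀ x : P, iota x = δ * x * δ⁻¹
  /-- "the unique order two `Δ`-outer automorphism over `G_k`" -/
  iota_unique : ∀ κ : P ≃ₜ* P,
    (∀ x : P, E.recon.projG (E.isoX (κ x)) = E.recon.projG (E.isoX x)) →
    (∃ δ : P, E.recon.projG (E.isoX δ) = 1 ∧ ∀ x : P, κ (κ x) = δ * x * δ⁻¹) →
    (¬ ∃ δ : P, E.recon.projG (E.isoX δ) = 1 ∧ ∀ x : P, κ x = δ * x * δ⁻¹) →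
      ∃ δ : P, E.recon.projG (E.isoX δ) = 1 ∧ ∀ x : P, κ x = δ * iota x * δ⁻¹
  /-- a representative of `ι_Ÿ`, an order-two (outer) automorphism of `Π_Ÿ(Π)` lifting `ι_X̲̲` -/
  iotaYdd : D.PiYdd ≃* D.PiYdd
  iotaYdd_lifts : ∃ δ : P, E.recon.projG (E.isoX δ) = 1 ∧
    ∀ y : D.PiYdd, ((iotaYdd y : D.PiYdd) : P) = δ * iota (y : P) * δ⁻¹
  /-- `D_{μ_-} ⊆ Π_Ÿ`, the decomposition group of `(μ_-)_Ÿ` (well-defined up to `Δ^tp_Ÿ`-conjugacy) -/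
  Dmu : Subgroup P
  Dmu_le : Dmu ≤ D.PiYdd
  /-- `ι_Ÿ` fixes (the conjugacy class of) `D_{μ_-}` -/
  iotaYdd_fixes : ∃ δ : D.PiYdd, E.recon.projG (E.isoX (δ : P)) = 1 ∧
    ∀ d : P, ∀ hd : d ∈ Dmu, ((iotaYdd ⟨d, Dmu_le hd⟩ : D.PiYdd) : P) ∈
      Dmu.map (MulAut.conj (δ : P)).toMonoidHom
  /-- `H¹(D_{μ_-}, (l·Δ_Θ)(Π))` (interface, additively written) with the restriction map from
  `H¹(Π_Ÿ(Π), (l·Δ_Θ)(Π))` -/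
  HDmu : Type u
  [grpHDmu : AddCommGroup HDmu]
  resDmu : D.coh.H1 ⊤ →+ HDmu
  /-- the distinguished orbit member: the class of (an `l`-th root of) THE étale theta function of standard
  type, "defined precisely by the condition that its restriction to `D_{μ_-}` be a `2l`-th root of unity"
  ([EtTh] Def. 1.9 (ii), 2.7). Only this member (not its `l·ℤ`-translates, whose values at `μ_-` have nonzero
  valuation by [EtTh] Prop. 1.4 (ii)) restricts to torsion — review of p407102 -/
  etaStd : D.coh.H1 ⊤
  etaStd_mem : etaStd ∈ D.orbit
  standard : (2 * S.l) • resDmu etaStd = 0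

attribute [instance] PointedInversion.grpHDmu

/-- **IUTchII:Rmk1.4.1(ii)** existence clause (kurims p. 28: "One verifies immediately that this implies
that there exists an order two automorphism `ι_Ÿ` of `Ÿ̲_k` lifting `ι_X̲̲` …"): over every
`Π ≅ Π^tp_{X̲̲_k}` with its Prop. 1.2 (i) / 1.4 outputs, pointed-inversion data exist. PREDICATE on the outputs
`(E, D)` (asserted by the text for the genuine ones; an axiom-free interface admits junk instances).
[claim: Mochizuki2012, status: disputed] (IUTchII §1 Rmk 1.4.1 (ii), kurims p.28) -/
def Rmk141_pointedInversion {P : TopGroup.{u}} (E : EnvOfGroup S P) (D : EtaleThetaData S P) : Prop :=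
  Nonempty (PointedInversion E D)

/-! ## Proposition 1.5: projective systems of mono-theta environments -/

/-- INTERFACE for **IUTchII:Prop1.5(i)** (kurims p. 29): the mod-`M` MODEL mono-theta environments
determined by `X̲̲_k` for every `M ∈ ℕ_{≥1}` ([EtTh] Def. 2.13 (ii); Cor. 2.19 (ii), (iii)), so that
"`M^Θ_M` is a mod `M` mono-theta environment [which is isomorphic to the mod `M` model mono-theta
environment determined by `X̲̲_k`]" makes sense for varying `M`. TODO-merge:abc-iut-L2-t2.
[claim: Mochizuki2012, status: disputed] (IUTchII §1 Prop 1.5, kurims p.29) -/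
structure ModelFamily (S : ThetaSetting.{u}) : Type (u + 1) where
  /-- `Π^tp_{Y̲}[μ_M]` -/
  modelPi : ℕ+ → TopGroup.{u}
  modelD : ∀ M, Subgroup (MulAut (modelPi M))
  modelD_inn : ∀ M, (MulAut.conj : modelPi M →* MulAut (modelPi M)).range ≤ modelD M
  modelD_continuous : ∀ M, ∀ φ ∈ modelD M, Continuous φ ∧ Continuous φ.symm
  modelTheta : ∀ M, Set (Subgroup (modelPi M))

/-- The setting `S` with `N` replaced by `M` and the mod-`M` model (all other data unchanged).
[claim: Mochizuki2012, status: disputed] (IUTchII §1 Prop 1.5, kurims p.29) -/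
def ModelFamily.setting (F : ModelFamily S) (M : ℕ+) : ThetaSetting.{u} :=
  { S with
    N := M
    modelPi := F.modelPi M
    modelD := F.modelD M
    modelD_inn := F.modelD_inn M
    modelD_continuous := F.modelD_continuous M
    modelTheta := F.modelTheta M }

/-- **IUTchII:Prop1.5(ii)** / the data of Proposition 1.5 (kurims p. 29): "a projective system of
mono-theta environments `M^Θ_* = {… → M^Θ_{M'} → M^Θ_M → …}` — where `M^Θ_M` is a mod `M` mono-theta
environment …, and the index `M` of the projective system varies multiplicatively among the elements of
`ℕ_{≥1}`", each member with its Def. 1.1 (i) output and with transition homomorphisms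
`Π_{M^Θ_{M'}} → Π_{M^Θ_M}`, `Π_X(M^Θ_{M'}) → Π_X(M^Θ_M)` for `M ∣ M'`, compatible with the quotients
`Π_M ↠ Π_Y ⊆ Π_X`. (A morphism of mono-theta environments `M_{M'} → M_M` is an isomorphism of the
induced mod-`M` environment with `M_M`, [EtTh] Def. 2.13 (ii); here only the underlying homomorphisms
and their functoriality are carried.) [claim: Mochizuki2012, status: disputed] (IUTchII §1 Prop 1.5, kurims p.29) -/
structure MonoThetaProjSystem (F : ModelFamily S) : Type (u + 1) where
  /-- `M^Θ_M` -/
  env : ∀ M : ℕ+, MonoThetaEnv (F.setting M)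
  /-- the Def. 1.1 (i) output of `M^Θ_M` -/
  recon : ∀ M : ℕ+, Reconstruction (env M)
  /-- transition `Π_{M^Θ_{M'}} → Π_{M^Θ_M}` for `M ∣ M'` -/
  trans : ∀ {M M' : ℕ+}, (M : ℕ) ∣ (M' : ℕ) → ((env M').Pi →* (env M).Pi)
  trans_continuous : ∀ {M M' : ℕ+} (h : (M : ℕ) ∣ (M' : ℕ)), Continuous (trans h)
  trans_refl : ∀ (M : ℕ+) (x : (env M).Pi), trans (dvd_refl (M : ℕ)) x = x
  trans_comp : ∀ {M M' M'' : ℕ+} (h : (M : ℕ) ∣ M') (h' : (M' : ℕ) ∣ M'') (x : (env M'').Pi),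
    trans h (trans h' x) = trans (dvd_trans h h') x
  /-- transition `Π_X(M^Θ_{M'}) → Π_X(M^Θ_M)` -/
  transX : ∀ {M M' : ℕ+}, (M : ℕ) ∣ (M' : ℕ) → ((recon M').PiX →* (recon M).PiX)
  transX_continuous : ∀ {M M' : ℕ+} (h : (M : ℕ) ∣ (M' : ℕ)), Continuous (transX h)
  /-- compatibility with `Π_M ↠ Π_Y(M) ⊆ Π_X(M)` -/
  transX_compat : ∀ {M M' : ℕ+} (h : (M : ℕ) ∣ (M' : ℕ)) (x : (env M').Pi),
    transX h ((recon M').inclY ((recon M').projY x)) = (recon M).inclY ((recon M).projY (trans h x))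

namespace MonoThetaProjSystem

variable {F : ModelFamily S} (Sys : MonoThetaProjSystem F)

/-- **IUTchII:Prop1.5(ii)** (kurims p. 29): "The transition morphisms of the resulting projective system
of topological groups `{… → Π_X(M^Θ_{M'}) → Π_X(M^Θ_M) → …}` are all isomorphisms. Moreover, any
isomorphism of topological groups `Π_X(M^Θ_{M'}) ≅ Π_X(M^Θ_M)`, where `M` divides `M'`, lifts to a
morphism of mono-theta environments `M^Θ_{M'} → M^Θ_M` [cf. [EtTh], Corollary 2.18, (iv)]." The lifting
clause is typed on underlying groups: every such isomorphism is induced, on `Π_Y`, by a continuous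
surjection `Π_{M^Θ_{M'}} ↠ Π_{M^Θ_M}`. Named `Prop`.
[claim: Mochizuki2012, status: disputed] (IUTchII §1 Prop 1.5 (ii), kurims p.29) -/
def transitionsAreIsos : Prop :=
  (∀ {M M' : ℕ+} (h : (M : ℕ) ∣ (M' : ℕ)),
      Function.Bijective (Sys.transX h) ∧ IsOpenMap (Sys.transX h)) ∧
  ∀ {M M' : ℕ+} (_h : (M : ℕ) ∣ (M' : ℕ)) (e : (Sys.recon M').PiX ≃ₜ* (Sys.recon M).PiX),
    ∃ φ : (Sys.env M').Pi →* (Sys.env M).Pi, Continuous φ ∧ Function.Surjective φ ∧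
      ∀ x, e ((Sys.recon M').inclY ((Sys.recon M').projY x)) =
        (Sys.recon M).inclY ((Sys.recon M).projY (φ x))

/-- **IUTchII:Prop1.5(ii)**, notation (kurims p. 29): "we shall identify these topological groups via
these transition morphisms and denote the resulting topological group by `Π_X(M^Θ_*)`" — realised as the
member at index `1` (every index maps to it). [claim: Mochizuki2012, status: disputed] (IUTchII §1 Prop 1.5 (ii), kurims p.29) -/
abbrev PiX : TopGroup.{u} := (Sys.recon 1).PiX

/-- The canonical map `Π_X(M^Θ_M) → Π_X(M^Θ_*)` (transition to index `1`).
[claim: Mochizuki2012, status: disputed] (IUTchII §1 Prop 1.5 (ii), kurims p.29) -/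
def toPiX (M : ℕ+) : (Sys.recon M).PiX →* Sys.PiX := Sys.transX (one_dvd (M : ℕ))

/-- **IUTchII:Prop1.5(iii)** (kurims p. 29): "The projective system of exterior cyclotomes
`{… → Π_μ(M^Θ_{M'}) → Π_μ(M^Θ_M) → …}` determines a projective limit exterior cyclotome `Π_μ(M^Θ_*)`"
— DEFINED as the group of compatible families (the transition maps preserve `Π_μ = Ker(Π ↠ Π_Y)` by
`transX_compat`). [claim: Mochizuki2012, status: disputed] (IUTchII §1 Prop 1.5 (iii), kurims p.29) -/
def extCycLim : Subgroup (∀ M : ℕ+, (Sys.env M).Pi) where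
  carrier := {x | (∀ M, x M ∈ (Sys.recon M).extCyc) ∧
    ∀ (M M' : ℕ+) (h : (M : ℕ) ∣ (M' : ℕ)), Sys.trans h (x M') = x M}
  mul_mem' := by
    rintro x y ⟨hx, hx'⟩ ⟨hy, hy'⟩
    refine ⟨fun M => Subgroup.mul_mem _ (hx M) (hy M), fun M M' h => ?_⟩
    simp [hx' M M' h, hy' M M' h]
  one_mem' := ⟨fun M => Subgroup.one_mem _, fun M M' h => by simp⟩
  inv_mem' := by
    rintro x ⟨hx, hx'⟩
    exact ⟨fun M => Subgroup.inv_mem _ (hx M), fun M M' h => by simp [hx' M M' h]⟩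

end MonoThetaProjSystem

/-- **IUTchII:Prop1.5(iii)** (kurims pp. 29–30), the limit rigidity isomorphism and `θ_env`: "`Π_μ(M^Θ_*)`
… is equipped with a uniquely determined cyclotomic rigidity isomorphism `(l·Δ_Θ)(M^Θ_*) ≅ Π_μ(M^Θ_*)`
[i.e., obtained by applying the cyclotomic rigidity isomorphisms of Definition 1.1, (ii), to the various
members of the projective system `M^Θ_*`]. In particular, [cf. Proposition 1.4] we obtain a functorial
algorithm `M^Θ_* ↦ θ_env(M^Θ_*) ⊆ H¹(Π_Ÿ(M^Θ_*), Π_μ(M^Θ_*))` … for constructing from `M^Θ_*` an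
exterior cyclotome version `θ_env(M^Θ_*)` of `θ(Π)` [i.e., by transporting `θ(Π)` via the above
cyclotomic rigidity isomorphism]", and `∞θ_env(M^Θ_*) ⊆ lim_J H¹(Π_Ÿ(M^Θ_*)|_J, Π_μ(M^Θ_*))` "the subset
of elements … for which some [positive integer] multiple coincides, up to torsion, with an element of
`θ_env(M^Θ_*)`; `J` ranges over the finite index open subgroups of `Π_X(M^Θ_*)`." DATA over a system:
the Prop. 1.4 output `D` for `Π_X(M^Θ_*)`, the limit rigidity isomorphism, its compatibility with the
mod-`M` ones, a second cohomology system (coefficients `Π_μ(M^Θ_*)`) with the coefficient-transport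
isomorphisms, and `θ_env` DEFINED by transport. [claim: Mochizuki2012, status: disputed] (IUTchII §1 Prop 1.5 (iii), kurims pp.29-30) -/
structure ThetaEnvData {F : ModelFamily S} (Sys : MonoThetaProjSystem F) : Type (u + 1) where
  /-- the Prop. 1.4 output for `Π = Π_X(M^Θ_*)` (gives `Π_Ÿ(M^Θ_*)`, `(l·Δ_Θ)(M^Θ_*)`, `θ`) -/
  D : EtaleThetaData S Sys.PiX
  /-- the mod-`M` cyclotomic rigidity isomorphisms of Def. 1.1 (ii) -/
  rigid : ∀ M : ℕ+, CyclotomicRigidity (Sys.recon M)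
  /-- the "uniquely determined" limit isomorphism `(l·Δ_Θ)(M^Θ_*) ≅ Π_μ(M^Θ_*)` -/
  rigidLim : D.lDeltaTheta.carrier ≃* Sys.extCycLim
  /-- identification of `(l·Δ_Θ)(Π_X(M^Θ_*))` with the interior cyclotome of each member mod `M` -/
  intCompat : ∀ M : ℕ+, D.lDeltaTheta.carrier →* ModPow (Sys.recon M).intCyc.carrier (M : ℕ)
  /-- "obtained by applying the cyclotomic rigidity isomorphisms of Def. 1.1 (ii) to the various members" -/
  rigidLim_compat : ∀ (M : ℕ+) (a : D.lDeltaTheta.carrier),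
    ((rigidLim a : ∀ M', (Sys.env M').Pi) M) = ((rigid M).iso (intCompat M a) : (Sys.env M).Pi)
  /-- `J ↦ H¹(Π_Ÿ(M^Θ_*)|_J, Π_μ(M^Θ_*))` (interface) -/
  cohEnv : CohomologySystem Sys.PiX
  /-- the isomorphisms on `H¹` induced by the coefficient isomorphism `(l·Δ_Θ) ≅ Π_μ` -/
  transportH1 : ∀ J, D.coh.H1 J ≃+ cohEnv.H1 J
  transportLim : D.coh.lim ≃+ cohEnv.lim
  transport_compat : ∀ (J : Subgroup Sys.PiX) (x : D.coh.H1 J),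
    cohEnv.toLim J (transportH1 J x) = transportLim (D.coh.toLim J x)

namespace ThetaEnvData

variable {F : ModelFamily S} {Sys : MonoThetaProjSystem F} (T : ThetaEnvData Sys)

/-- **IUTchII:Prop1.5(iii)**: `θ_env(M^Θ_*) ⊆ H¹(Π_Ÿ(M^Θ_*), Π_μ(M^Θ_*))`, DEFINED "by transporting `θ(Π)`
via the above cyclotomic rigidity isomorphism". [claim: Mochizuki2012, status: disputed] (IUTchII §1 Prop 1.5 (iii), kurims p.30) -/
def thetaEnv : Set (T.cohEnv.H1 ⊤) := T.transportH1 ⊤ '' T.D.theta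

/-- **IUTchII:Prop1.5(iii)**: `∞θ_env(M^Θ_*) ⊆ lim_J H¹(Π_Ÿ(M^Θ_*)|_J, Π_μ(M^Θ_*))`, DEFINED as printed:
elements some positive multiple of which coincides, up to torsion, with an element of `θ_env(M^Θ_*)`.
[claim: Mochizuki2012, status: disputed] (IUTchII §1 Prop 1.5 (iii), kurims p.30) -/
def thetaEnvInfty : Set T.cohEnv.lim :=
  {x | ∃ (n : ℕ), 0 < n ∧ ∃ t ∈ T.thetaEnv, IsOfFinAddOrder (n • x - T.cohEnv.toLim ⊤ t)}

/-- Consistency of the two printed definitions: `∞θ_env` is the transport of `∞θ` (Prop. 1.4) along the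
coefficient isomorphism — a definitional check, PROVED. [claim: Mochizuki2012, status: disputed] (IUTchII §1 Prop 1.5 (iii), kurims p.30) -/
theorem thetaEnvInfty_eq_image : T.thetaEnvInfty = T.transportLim '' T.D.thetaInfty := by
  ext x
  constructor
  · rintro ⟨n, hn, t, ⟨t0, ht0, rfl⟩, htor⟩
    refine ⟨T.transportLim.symm x, ⟨n, hn, t0, ht0, ?_⟩, by simp⟩
    have h1 : T.transportLim.symm (n • x - T.cohEnv.toLim ⊤ (T.transportH1 ⊤ t0)) =
        n • T.transportLim.symm x - T.D.coh.toLim ⊤ t0 := by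
      rw [map_sub, map_nsmul, T.transport_compat, AddEquiv.symm_apply_apply]
    rw [← h1]
    simpa using T.transportLim.symm.toAddMonoidHom.isOfFinAddOrder htor
  · rintro ⟨y, ⟨n, hn, t0, ht0, htor⟩, rfl⟩
    refine ⟨n, hn, T.transportH1 ⊤ t0, ⟨t0, ht0, rfl⟩, ?_⟩
    have h1 : T.transportLim (n • y - T.D.coh.toLim ⊤ t0) =
        n • T.transportLim y - T.cohEnv.toLim ⊤ (T.transportH1 ⊤ t0) := by
      rw [map_sub, map_nsmul, T.transport_compat]
    rw [← h1]
    simpa using T.transportLim.toAddMonoidHom.isOfFinAddOrder htor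

end ThetaEnvData

/-- **IUTchII:Prop1.5(i)** (kurims p. 29): "Such a projective system is uniquely determined, up to
isomorphism, by `X̲̲_k` [cf. Remark 1.5.1 below; the discrete rigidity property of [EtTh], Corollary 2.19,
(ii)]." Typed: any two projective systems over the same model family are isomorphic by a compatible
family of isomorphisms of mono-theta environments. PREDICATE on the pair of systems `(A, B)`.
[claim: Mochizuki2012, status: disputed] (IUTchII §1 Prop 1.5 (i), kurims p.29) -/
def Prop15_i {F : ModelFamily S} (A B : MonoThetaProjSystem F) : Prop :=
    ∃ e : ∀ M : ℕ+, MonoThetaEnv.Iso (A.env M) (B.env M),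
      ∀ {M M' : ℕ+} (h : (M : ℕ) ∣ (M' : ℕ)) (x : (A.env M').Pi),
        (e M).iso (A.trans h x) = B.trans h ((e M').iso x)

/-- **IUTchII:Prop1.5(ii)**–**(iii)** existence clause (kurims pp. 29–30): for every projective system the
transition isomorphism/lifting property holds and the limit rigidity / `θ_env` data exist. PREDICATE on the
projective system `Sys`. (The printed "uniquely determined" for the LIMIT isomorphism is automatic —
`rigidLim_compat` plus extensionality in `∏_M Π_M`, review of p407102 — and is therefore not a conjunct; the
uniqueness with content is that of the Def. 1.1 (ii) isomorphisms, [EtTh] Cor. 2.19 (i), owner abc-iut-L2-t2.) [claim: Mochizuki2012, status: disputed] (IUTchII §1 Prop 1.5 (ii)(iii), kurims pp.29-30) -/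
def Prop15_ii_iii {F : ModelFamily S} (Sys : MonoThetaProjSystem F) : Prop :=
    Sys.transitionsAreIsos ∧ Nonempty (ThetaEnvData Sys)

/-- **IUTchII:Prop1.5(iv)** (kurims p. 30): "Suppose that `M^Θ_*` arises from a tempered Frobenioid `𝒞`
[cf. Propositions 1.2, (ii); 1.3]. Then this construction of `θ_env(M^Θ_*)` [cf. (iii)] is compatible with
the Kummer-theoretic construction of the étale theta function — i.e., by considering Galois actions on
roots of the Frobenioid-theoretic theta function [cf. the theory of [EtTh], §5]. In particular, it is
compatible with the Kummer theory of the base-field-theoretic hull `𝒞^{bs-fld}` [cf. [FrdII], Theorem 2.4;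
[AbsTopIII], Proposition 3.2, (ii); [AbsTopIII], Remark 3.1.1]." INTERFACE-level typing as a PREDICATE on
the Kummer-theoretic theta classes `θ_Kum ⊆ H¹(Π_Ÿ(M^Θ_*), Π_μ(M^Θ_*))` that [EtTh] §5 attaches to `𝒞`
(owner abc-iut-L2-t4; not constructible here): the printed compatibility is the equation `θ_Kum = θ_env`.
TODO-merge:abc-iut-L2-t4. [claim: Mochizuki2012, status: disputed] (IUTchII §1 Prop 1.5 (iv), kurims p.30) -/
def Prop15_iv_compatible {F : ModelFamily S} {Sys : MonoThetaProjSystem F} (T : ThetaEnvData Sys)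
    (thetaKum : Set (T.cohEnv.H1 ⊤)) : Prop :=
  thetaKum = T.thetaEnv

/-! ## Remarks 1.5.1, 1.5.2 -/

/-- **IUTchII:Rmk1.5.2** (kurims pp. 30–31): "by considering tautological Kummer classes of elements of
`Π_μ(M^Θ_*)`, one obtains a natural `Π_X(M^Θ_*)`-equivariant injection
`Π_μ(M^Θ_*) ⊗ ℚ/ℤ ↪ lim_J H¹(Π_Ÿ(M^Θ_*)|_J, Π_μ(M^Θ_*))` whose image is equal to the torsion subgroup of
the codomain of the injection" (via the Kummer theory of MLF's). Typed over the cohomology interface,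
with `Π_μ(M^Θ_*) ⊗ ℚ/ℤ` carried as an abstract (additive) group `Q` supplied with the data:
an injective homomorphism `Q → lim_J H¹` with image the torsion elements. WEAKENING: the printed
`Π_X(M^Θ_*)`-equivariance is not typed (the cohomology interface `cohEnv` carries no `Π_X`-action). (`IUTchII:Rmk1.5.1`, p. 30,
is expository — discrete rigidity vs. `l·Ẑ`-translates — and carries no separately typed claim.)
[claim: Mochizuki2012, status: disputed] (IUTchII §1 Rmk 1.5.2, kurims pp.30-31) -/
def Rmk152_kummerTorsion {F : ModelFamily S} {Sys : MonoThetaProjSystem F} (T : ThetaEnvData Sys)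
    (Q : Type u) [AddCommGroup Q] (κ : Q →+ T.cohEnv.lim) : Prop :=
  Function.Injective κ ∧ Set.range κ = {x | IsOfFinAddOrder x}

/-! ## Proposition 1.6: cores and elliptic cuspidalisations ([AbsTopII] Cor. 3.3) -/

/-- **IUTchII:Prop1.6(i)** (kurims p. 31) "(Cores)", OUTPUT of `Π ↦ {(Π ⊆) Π_C(Π) ↠ Π/Δ}` for
`Π ≅ Π^tp_{X̲̲_k}` with `Δ ⊆ Π` "the [group-theoretic! — cf., e.g., [AbsAnab], Lemma 1.3.8] subgroup
corresponding to `Δ^tp_{X̲̲_k}`": "a topological group `Π_C(Π)` equipped with an augmentation [i.e., a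
surjection] `Π_C(Π) ↠ Π/Δ` — whose kernel we denote by `Δ_C(Π)` — that contains `Π` as an open subgroup
in a fashion that is compatible with the respective surjections to `Π/Δ` and which satisfies the property
that when `Π = Π^tp_{X̲̲_k}`, the inclusion `Π ⊆ Π_C(Π)` may be naturally identified with the inclusion
`Π^tp_{X̲̲_k} ⊆ Π^tp_{C_k}`." The reference inclusion `Π^tp_{X̲̲_k} ⊆ Π^tp_{C_k}` is an interface datum
(`PiCRef`, `inclRef`; TODO-merge:abc-iut-L3-t2). [claim: Mochizuki2012, status: disputed] (IUTchII §1 Prop 1.6 (i), kurims p.31) -/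
structure CoreData (S : ThetaSetting.{u}) (P : TopGroup.{u}) : Type (u + 1) where
  isoRef : Nonempty (P ≃ₜ* S.PiX)
  /-- `Δ ⊆ Π`, the subgroup corresponding to `Δ^tp_{X̲̲_k}` (characteristic: transported by every iso) -/
  Delta : Subgroup P
  [Delta_normal : Delta.Normal]
  Delta_corresponds : ∀ e : P ≃ₜ* S.PiX, Delta.map e.toMulEquiv.toMonoidHom = S.DeltaX
  /-- `Π_C(Π)` with `Π ⊆ Π_C(Π)` open -/
  PiC : TopGroup.{u}
  incl : P →* PiC
  incl_isOpenEmbedding : Topology.IsOpenEmbedding incl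
  /-- the augmentation `Π_C(Π) ↠ Π/Δ`, compatible with `Π ↠ Π/Δ` -/
  augC : PiC →* P ⧸ Delta
  augC_continuous : Continuous augC
  augC_surjective : Function.Surjective augC
  augC_compat : ∀ x : P, augC (incl x) = QuotientGroup.mk x
  /-- reference data: `Π^tp_{C_k}` with `Π^tp_{X̲̲_k} ⊆ Π^tp_{C_k}` (interface) -/
  PiCRef : TopGroup.{u}
  inclRef : S.PiX →* PiCRef
  /-- "may be naturally identified with the inclusion `Π^tp_{X̲̲_k} ⊆ Π^tp_{C_k}`" -/
  identified : ∃ (e : P ≃ₜ* S.PiX) (eC : PiC ≃ₜ* PiCRef), ∀ x : P, eC (incl x) = inclRef (e x)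

attribute [instance] CoreData.Delta_normal

/-- `Δ_C(Π) := Ker(Π_C(Π) ↠ Π/Δ)` (Prop. 1.6 (i)). [claim: Mochizuki2012, status: disputed] (IUTchII §1 Prop 1.6 (i), kurims p.31) -/
abbrev CoreData.DeltaC {P : TopGroup.{u}} (C : CoreData S P) : Subgroup C.PiC := C.augC.ker

/-! **Existence clause** of Prop. 1.6 (i) ("there exists a functorial group-theoretic algorithm …"): NOT typed as a named
fact (reviews of `MonoThetaCyclotomes`: over an axiom-free interface the transport form is trivially provable and
the unguarded form is false for junk settings). The existence content is the owners' construction of the output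
below for the genuine reference group ([AbsTopII] Cor. 3.3 (i), abc-iut-L4-t4); functoriality = transport of the output structure along `≃ₜ*`. -/

/-- **IUTchII:Prop1.6(ii)** (kurims p. 31) "(Elliptic Cuspidalizations)", OUTPUT of `Π ↦ {Π_{U_N}(Π) ↠ Π}`:
"a topological group `Π_{U_N}(Π)` equipped with a surjection `Π_{U_N}(Π) ↠ Π` [so the augmentation
`Π ↠ Π/Δ` determines, by composition, an augmentation `Π_{U_N}(Π) ↠ Π/Δ`] such that when
`Π = Π^tp_{X̲̲_k}`, the surjection `Π_{U_N}(Π) ↠ Π` may be naturally identified with a certain surjection —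
i.e., "elliptic cuspidalization" — that arises from a certain open immersion determined by the
`N`-torsion points of a once-punctured elliptic curve that forms a double covering of `C_k` [cf.
[AbsTopII], Corollary 3.3, (iii)]." The reference surjection `projRef` is an interface datum
(TODO-merge:abc-iut-L4-t4, [AbsTopII] Cor. 3.3 (iii)) — the one the owner supplies FOR THIS `N`; formally `N`
is a LABEL only (no field depends on it), to be tied to the `N`-torsion open immersion at merge.
[claim: Mochizuki2012, status: disputed] (IUTchII §1 Prop 1.6 (ii), kurims p.31) -/
structure EllipticCuspidalization (S : ThetaSetting.{u}) (N : ℕ+) (P : TopGroup.{u}) : Type (u + 1) where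
  isoRef : Nonempty (P ≃ₜ* S.PiX)
  /-- `Π_{U_N}(Π)` -/
  PiU : TopGroup.{u}
  proj : PiU →* P
  proj_continuous : Continuous proj
  proj_surjective : Function.Surjective proj
  /-- reference: `Π^tp_{U_N} ↠ Π^tp_{X̲̲_k}`, the elliptic cuspidalisation surjection (interface) -/
  PiURef : TopGroup.{u}
  projRef : PiURef →* S.PiX
  identified : ∃ (e : P ≃ₜ* S.PiX) (eU : PiU ≃ₜ* PiURef), ∀ y : PiU, projRef (eU y) = e (proj y)

/-! **Existence clause** of Prop. 1.6 (ii) (and the expository `IUTchII:Rmk1.6.1`, pp. 31–32: cores = centraliser computations, cuspidalisations = outer isomorphisms between subquotients — noted) ("there exists a functorial group-theoretic algorithm …"): NOT typed as a named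
fact (reviews of `MonoThetaCyclotomes`: over an axiom-free interface the transport form is trivially provable and
the unguarded form is false for junk settings). The existence content is the owners' construction of the output
below for the genuine reference group ([AbsTopII] Cor. 3.3 (iii), abc-iut-L4-t4); functoriality = transport of the output structure along `≃ₜ*`. -/

end Literature.IUT.HodgeArakelov
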